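import Summits.KontsevichZagierPeriods.KontsevichZagierPeriods.Theorems.HoffmanRelationInKZ.Negative.WindowWeightFour
import Summits.KontsevichZagierPeriods.KontsevichZagierPeriods.Theses.Deregularisation
import Literature.NumberTheory.Transcendental.KZLogCalculusProofs

/-!
# Crux `HoffmanRelationInKZ` (stmt-KontsevichZagierPeriods-3930): the first live instance is Deregularisation's `HoffmanWeightFour`

Landed copy of §7 of `Cruxes/HoffmanRelationInKZ/Disproof.lean` (crux disprover):
`atThree_iff_hoffmanWeightFour` — the `s = (3)` instance of the crux (and of the twin stmt-3167) is
equivalent to route Deregularisation's crux `HoffmanWeightFour` (stmt-KontsevichZagierPeriods-3906):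
representations with the literal domain `{1 > t₀ > t₁ > t₂ > t₃ > 0}` whose integrands agree on it
with the simplex integrands are KZ-equivalent to the simplex representations
(`KZ.of_sub_of_mem_relations_of_eqOn`, Literature `KZLogCalculusProofs`). A refutation of 3906 refutes
this crux and the summit; a proof of it is the first rung here.

References: M. Kontsevich, D. Zagier, *Periods* (2001), §1.2 rule (1).
-/

noncomputable section

namespace Summit.KontsevichZagierPeriods.HoffmanRelationInKZ.Negative

open MeasureTheory Set
open Literature.NumberTheory.Transcendental
open Literature.NumberTheory.Transcendental.KZ
open Summit.KontsevichZagierPeriods.KontsevichZagierPeriods.Theses.FurushoPentagon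

/-! ## Cross-route: the first live instance IS Deregularisation's `HoffmanWeightFour` (stmt-3906)

`HoffmanWeightFour` quantifies over arbitrary representations with the literal domain
`{1 > t₀ > t₁ > t₂ > t₃ > 0}` and the three rational integrands; representations with the same domain
whose integrands agree ON the domain are equivalent (integrand additivity with a zero representation,
`KZ.of_sub_of_mem_relations_of_eqOn`), so it is equivalent to the `s = (3)` instance of this crux (and of the twin 3167). A refutation of
stmt-3906 therefore refutes this crux and the summit; a proof of it is the recommended first rung here. -/

section CrossRoute

/-- The literal domain of `HoffmanWeightFour` / Grothendieck 0275 is the open ordered 4-simplex. -/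
theorem chainSet_eq_openOrderedSimplex :
    {t : Fin 4 → ℝ | 1 > t 0 ∧ t 0 > t 1 ∧ t 1 > t 2 ∧ t 2 > t 3 ∧ t 3 > 0} = openOrderedSimplex 4 := by
  ext t
  simp only [Set.mem_setOf_eq, openOrderedSimplex]
  constructor
  · rintro ⟨h0, h1, h2, h3, h4⟩
    refine ⟨fun i => ?_, fun i => ?_, fun i j hij => ?_⟩
    · fin_cases i <;> simp <;> linarith
    · fin_cases i <;> simp <;> linarith
    · fin_cases i <;> fin_cases j <;> simp at hij ⊢ <;> linarith
  · rintro ⟨hpos, hlt, hanti⟩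
    exact ⟨hlt 0, hanti (show (0 : Fin 4) < 1 by decide), hanti (show (1 : Fin 4) < 2 by decide),
      hanti (show (2 : Fin 4) < 3 by decide), hpos 3⟩

/-- **`Hoffman(3)` in this crux ⟺ `Deregularisation.HoffmanWeightFour`.** [folklore] -/
theorem atThree_iff_hoffmanWeightFour :
    hoffmanElement zetaRep [3] ∈ relations ↔ Summit.KontsevichZagierPeriods.KontsevichZagierPeriods.Theses.Deregularisation.HoffmanWeightFour := by
  have h4 : MZV.IsAdmissible [4] := by decide
  have h31 : MZV.IsAdmissible [3, 1] := by decide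
  have h22 : MZV.IsAdmissible [2, 2] := by decide
  have hd4 : (zRep [4] h4 : IntegralRep 4).domain =
      {t : Fin 4 → ℝ | 1 > t 0 ∧ t 0 > t 1 ∧ t 1 > t 2 ∧ t 2 > t 3 ∧ t 3 > 0} :=
    chainSet_eq_openOrderedSimplex.symm
  have hf4 : ∀ t : Fin 4 → ℝ, (zRep [4] h4 : IntegralRep 4).integrand t = 1 / (t 0 * t 1 * t 2 * (1 - t 3)) := by
    intro t; change mzvIntegrand [4] t = _; rw [mzvIntegrand_four, one_div, mul_inv, mul_inv, mul_inv]
  have hf31 : ∀ t : Fin 4 → ℝ, (zRep [3, 1] h31 : IntegralRep 4).integrand t =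
      1 / (t 0 * t 1 * (1 - t 2) * (1 - t 3)) := by
    intro t; change mzvIntegrand [3, 1] t = _; rw [mzvIntegrand_three_one, one_div, mul_inv, mul_inv, mul_inv]
  have hf22 : ∀ t : Fin 4 → ℝ, (zRep [2, 2] h22 : IntegralRep 4).integrand t =
      1 / (t 0 * (1 - t 1) * t 2 * (1 - t 3)) := by
    intro t; change mzvIntegrand [2, 2] t = _; rw [mzvIntegrand_two_two, one_div, mul_inv, mul_inv, mul_inv]
  rw [hoffmanElement_three, zetaRep_of_isAdmissible h4, zetaRep_of_isAdmissible h31,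
    zetaRep_of_isAdmissible h22]
  constructor
  · intro hH r₁ r₂ r₃ hd₁ hf₁ hd₂ hf₂ hd₃ hf₃
    have e₁ : of r₁ - of (zRep [4] h4 : IntegralRep 4) ∈ relations :=
      of_sub_of_mem_relations_of_eqOn (by rw [hd4, hd₁]) fun t ht => by rw [hf₁ ht, hf4]
    have e₂ : of r₂ - of (zRep [3, 1] h31 : IntegralRep 4) ∈ relations :=
      of_sub_of_mem_relations_of_eqOn (by rw [hd₂, hd₁]; exact hd4) fun t ht => by rw [hf₂ ht, hf31]
    have e₃ : of r₃ - of (zRep [2, 2] h22 : IntegralRep 4) ∈ relations :=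
      of_sub_of_mem_relations_of_eqOn (by rw [hd₃, hd₁]; exact hd4) fun t ht => by rw [hf₃ ht, hf22]
    have e : of r₁ - of r₂ - of r₃ =
        (of r₁ - of (zRep [4] h4 : IntegralRep 4)) - (of r₂ - of (zRep [3, 1] h31 : IntegralRep 4)) -
          (of r₃ - of (zRep [2, 2] h22 : IntegralRep 4)) +
          (of (zRep [4] h4) - (of (zRep [3, 1] h31) + of (zRep [2, 2] h22))) := by
      abel
    rw [e]
    exact relations.add_mem (relations.sub_mem (relations.sub_mem e₁ e₂) e₃) hH
  · intro hW
    have := hW (zRep [4] h4) (zRep [3, 1] h31) (zRep [2, 2] h22) hd4 (fun t _ => hf4 t) rfl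
      (fun t _ => hf31 t) rfl (fun t _ => hf22 t)
    rw [← sub_sub]
    exact this

end CrossRoute


end Summit.KontsevichZagierPeriods.HoffmanRelationInKZ.Negative
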